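import Summits.ResolutionOfSingularities.ResolutionOfSingularities.Theorems.PurelyInseparableDim4ResConeWeightsGeneric
import Summits.ResolutionOfSingularities.ResolutionOfSingularities.Theorems.PurelyInseparableDim4ResConeLossFreeTail
import HarnessLib
import HarnessLib.Audit.Tags

/-!
# Purely inseparable four-folds — the LIGHT QUAD `(1,1,1,1)`: a light tail at shade `p − 3` is a PURE CORNER chain
# (no translation ever, every prime, any `e_G`), hence DEAD for binary cones by C13; so every binary-cone tail of shade
# `d ≤ p − 3` is eventually HEAVY (cell `res-dim4-pi`, K2(p) lane, rung-1 generic brick; no `7` in any signature)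

[OURS · counted 0 · cell `res-dim4-pi` · K2(p) lane (holder res-dim4-p-12 g4; K2(7) scoping v1 §3: «generic files (no `7` in a
signature) are always welcome») · seat res-dim4-p-3 g5.]  Nothing here proves K2(p) for any `p`, `NoIsolatedTrap p p`, the
Cossart–Jannsen–Saito theorem or resolution of singularities in dimension ≥ 4 / characteristic `p` — NOT proved.  AI kernel
work, weaker than expert review.

By `…WeightsGeneric` (`shadeWeights_dichotomy`) a constant-shade-`d` tail of a witnessed isolated above-floor `Step0 p` chain is
LIGHT (all boundary weights `≤ 1`, `|r_k| = p + 1 − d`) for ever or eventually HEAVY; a light state has `p + 1 − d ≤ 4` letters,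
so light tails exist only at `d ∈ {p−1, p−2, p−3}`: the light PAIR (res-dim4-p-5 g5, dead for binary cones ∀ p), the light
TRIPLE (the lossy-rotation regime), and the light QUAD `(1,1,1,1)` at `d = p − 3` — the holder's weight-ledger census lists it
as the one light recurrent class of `(7,4)`.  This file settles the quad for every prime:
* §1 CORE (pure `(r, j, b)` numerics in `tail_weights_laws`' syntax): `degree_le_three_of_le_one_of_eq_zero`,
  `apply_eq_one_of_light_four`, **`light_four_translation_eq_zero`** — with all four letters on the boundary at weight `1` a
  translated letter would be LOST and the child would have `|r| ≤ 3 <` floor: so `b k = 0` for every `k ≥ k₀` (PURE CORNER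
  chain), `light_four_apply_eq_one`.
* §2 DRESS `(p : ℕ) [Fact p.Prime]`, any `e_G`: **`lightQuad_translation_eq_zero`** (pure corner chain; with FT
  `exists_satellite_ge` the chart letter then changes infinitely often); and for BINARY CONES (`e_G ≡ 2`): **`no_lightQuad_tail`** (a pure corner chain is loss-free ⇒ res-dim4-p-5 g3's C13 `no_lossfree_tail (p)`), hence
  **`binaryCone_eventually_heavy_of_add_three_le`**: every witnessed isolated above-floor binary-cone tail of constant shade
  `d ≤ p − 3` carries a boundary letter of weight `≥ 2` from some time on (at `p = 7`: TAIL(7,3,2) and TAIL(7,4,2) have NO light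
  sub-branch; with p-5's `eventually_heavy_prime` at `d = p − 1`, the only light binary-cone residue for every `p` is the TRIPLE
  at `d = p − 2`).
NOT here: the power-cone (`e_G = 3`) light quad — a pure corner chain by §2, but its kill (a window game at `(p, p−3)`?) is the
holder's rung-0 (d) question; the light triple.

[cite: CossartJannsenSaito2020, Thm. 3.14, Lemma 13.2] [cite: HauserPerlega2019PRIMS, §2 (transform D′ of D)]
bears_on: LADDER-RESOLUTION:D157-DOOR2 (res-dim4-pi · K2(p) · light quad every prime).  Supports
stmt-ResolutionOfSingularities-16155 (helper).
-/

set_option linter.dupNamespace false -- mandated namespace of this single-conjunct summit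

noncomputable section

namespace Summit.ResolutionOfSingularities.ResolutionOfSingularities.Theorems.PIDim4

namespace ResCone

open MvPolynomial Finset
open Literature.AlgebraicGeometry.Resolution
open Literature.AlgebraicGeometry.Resolution.CentreBlowup
open Literature.AlgebraicGeometry.Resolution.Hauser2010
open Literature.AlgebraicGeometry.Resolution.HauserPerlega2019

variable {K : Type} [Field K]

/-! ## 1. Core numerics: four letters of weight `1` admit no translation -/

section Core

variable [DecidableEq K] {r : ℕ → Fin 4 →₀ ℕ} {j : ℕ → Fin 4} {b : ℕ → Fin 4 → K} {k₀ p d : ℕ}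

/-- Four weights `≤ 1`, one of them `0`, weigh `≤ 3` in total. [folklore] -/
theorem degree_le_three_of_le_one_of_eq_zero {f : Fin 4 →₀ ℕ} (h1 : ∀ i, f i ≤ 1) {N : Fin 4} (hN : f N = 0) :
    f.degree ≤ 3 := by
  classical
  rw [Finsupp.degree_eq_sum, ← Finset.add_sum_erase _ _ (Finset.mem_univ N), hN, zero_add]
  have h := Finset.sum_le_card_nsmul (Finset.univ.erase N) (fun i => f i) 1 (fun i _ => h1 i)
  rw [Finset.card_erase_of_mem (Finset.mem_univ N), Finset.card_univ, Fintype.card_fin] at h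
  simpa using h

/-- In a light state of total weight `4` every letter is a boundary letter of weight exactly `1`. [folklore] -/
theorem apply_eq_one_of_light_four {f : Fin 4 →₀ ℕ} (h1 : ∀ i, f i ≤ 1) (h4 : f.degree = 4) (i : Fin 4) :
    f i = 1 := by
  by_contra h
  have h0 : f i = 0 := by have := h1 i; omega
  have := degree_le_three_of_le_one_of_eq_zero h1 h0
  omega

/-- **THE LIGHT QUAD IS A PURE CORNER CHAIN** (core form, every `(p, d)` with `d + 3 = p`): along a light tail with
`|r_k| + d = p + 1`, i.e. `|r_k| = 4`, no coordinate is ever translated — a translated letter `i ≠ j k` is lost, and the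
child, light again, would weigh `≤ 3`. [OURS] [folklore] -/
theorem light_four_translation_eq_zero
    (hlaw : ∀ k, k₀ ≤ k → r (k + 1) = ((r k).filter (fun i => b k i = 0)).update (j k) ((r k).degree + d - p))
    (hbj : ∀ k, b k (j k) = 0)
    (hlight : ∀ k, k₀ ≤ k → (∀ i, r k i ≤ 1) ∧ (r k).degree + d = p + 1) (h3 : d + 3 = p)
    {k : ℕ} (hk : k₀ ≤ k) (i : Fin 4) : b k i = 0 := by
  by_contra hbi
  have hij : i ≠ j k := fun h => hbi (h ▸ hbj k)
  have h0 : r (k + 1) i = 0 := by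
    rw [law_apply_of_update (hlaw k hk) i, if_neg hij, if_neg hbi]
  obtain ⟨h1', hdeg'⟩ := hlight (k + 1) (by omega)
  have := degree_le_three_of_le_one_of_eq_zero h1' h0
  omega

/-- Along a light quad tail every letter weighs exactly `1` at every time. [OURS] [folklore] -/
theorem light_four_apply_eq_one
    (hlight : ∀ k, k₀ ≤ k → (∀ i, r k i ≤ 1) ∧ (r k).degree + d = p + 1) (h3 : d + 3 = p)
    {k : ℕ} (hk : k₀ ≤ k) (i : Fin 4) : r k i = 1 :=
  apply_eq_one_of_light_four (hlight k hk).1 (by have := (hlight k hk).2; omega) i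

end Core

/-! ## 2. The dress: light quad tails of witnessed isolated above-floor `Step0 p` chains -/

section Chain

variable [DecidableEq K]

/-- **A LIGHT QUAD TAIL IS A PURE CORNER CHAIN**, every prime `p`, any `e_G`: along a witnessed isolated above-floor `Step0 p`
chain with `x^{r₀} ∣ F₀`, constant shade `d = p − 3` from `k₀` and LIGHT for ever, every translation vector vanishes:
`b k = 0` for `k ≥ k₀`. [OURS] [folklore] -/
theorem lightQuad_translation_eq_zero (p : ℕ) [Fact p.Prime] {c : ℕ → State K} {j : ℕ → Fin 4}
    {b : ℕ → Fin 4 → K} (hc : ∀ k, IsIsolated p (c k).F ∧ Step0 p (c k) (c (k + 1)))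
    (hw : FreeTail.IsWitnessedChain p c j b) (hr0 : ∀ e ∈ (c 0).F.support, (c 0).r ≤ e)
    (hfloor : ∀ k, ordZero (c k).F ≠ p) {k₀ d : ℕ} (hshade : ∀ k, k₀ ≤ k → (c k).shade = (d : ℕ∞))
    (h3 : d + 3 = p) (hlight : ∀ k, k₀ ≤ k → (∀ i, (c k).r i ≤ 1) ∧ (c k).r.degree + d = p + 1) {k : ℕ}
    (hk : k₀ ≤ k) (i : Fin 4) : b k i = 0 := by
  obtain ⟨-, hlaw, hbj, -, -⟩ := tail_weights_laws hc hw hr0 hfloor hshade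
  exact light_four_translation_eq_zero hlaw hbj hlight h3 hk i

/-- **THE BINARY-CONE LIGHT QUAD TAIL IS EMPTY, every prime `p`**: along a witnessed isolated above-floor `Step0 p` chain with
`x^{r₀} ∣ F₀`, constant shade `d = p − 3` and `e_G ≡ 2` from `k₀`, the weights cannot stay light for ever — a light quad tail is
a pure corner chain, hence loss-free, and res-dim4-p-5 g3's C13 `no_lossfree_tail` kills every loss-free binary-cone tail.
[OURS] [cite: CossartJannsenSaito2020, Thm. 3.14, Lemma 13.2] -/
theorem no_lightQuad_tail (p : ℕ) [Fact p.Prime] [CharP K p] {c : ℕ → State K} {j : ℕ → Fin 4}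
    {b : ℕ → Fin 4 → K} (hc : ∀ k, IsIsolated p (c k).F ∧ Step0 p (c k) (c (k + 1)))
    (hw : FreeTail.IsWitnessedChain p c j b) (hr0 : ∀ e ∈ (c 0).F.support, (c 0).r ≤ e)
    (hfloor : ∀ k, ordZero (c k).F ≠ p) {k₀ d : ℕ} (hshade : ∀ k, k₀ ≤ k → (c k).shade = (d : ℕ∞))
    (h3 : d + 3 = p) (he : ∀ k, k₀ ≤ k → Module.finrank K (resVertex (c k)) = 2)
    (hlight : ∀ k, k₀ ≤ k → (∀ i, (c k).r i ≤ 1) ∧ (c k).r.degree + d = p + 1) : False :=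
  no_lossfree_tail p hc hw hr0 hfloor (by omega) hshade he fun k hk i hbi =>
    absurd (lightQuad_translation_eq_zero p hc hw hr0 hfloor hshade h3 hlight hk i) hbi

/-- **EVERY BINARY-CONE TAIL OF SHADE `d ≤ p − 3` IS EVENTUALLY HEAVY, every prime `p`**: along a witnessed isolated
above-floor `Step0 p` chain with `x^{r₀} ∣ F₀`, constant shade `d` with `d + 3 ≤ p` and `e_G ≡ 2` from `k₀`, from some
`k₁ ≥ k₀` on every state has a boundary letter of weight `≥ 2` (`d + 4 ≤ p`: `shadeWeights_eventually_heavy`, no room for a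
light state; `d + 3 = p`: the light quad is dead).  At `p = 7`: TAIL(7,3,2) and TAIL(7,4,2) have no light sub-branch.
[OURS] [cite: CossartJannsenSaito2020, Thm. 3.14] -/
theorem binaryCone_eventually_heavy_of_add_three_le (p : ℕ) [Fact p.Prime] [CharP K p] {c : ℕ → State K}
    {j : ℕ → Fin 4} {b : ℕ → Fin 4 → K} (hc : ∀ k, IsIsolated p (c k).F ∧ Step0 p (c k) (c (k + 1)))
    (hw : FreeTail.IsWitnessedChain p c j b) (hr0 : ∀ e ∈ (c 0).F.support, (c 0).r ≤ e)
    (hfloor : ∀ k, ordZero (c k).F ≠ p) {k₀ d : ℕ} (hshade : ∀ k, k₀ ≤ k → (c k).shade = (d : ℕ∞))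
    (h3 : d + 3 ≤ p) (he : ∀ k, k₀ ≤ k → Module.finrank K (resVertex (c k)) = 2) :
    ∃ k₁, k₀ ≤ k₁ ∧ ∀ k, k₁ ≤ k → ∃ W, 2 ≤ (c k).r W := by
  rcases Nat.lt_or_ge (d + 3) p with hlt | hge
  · exact shadeWeights_eventually_heavy p hc hw hr0 hfloor hshade (by omega)
  · rcases shadeWeights_dichotomy p hc hw hr0 hfloor hshade with hlight | hheavy
    · exact (no_lightQuad_tail p hc hw hr0 hfloor hshade (by omega) he hlight).elim
    · exact hheavy

end Chain

end ResCone

end Summit.ResolutionOfSingularities.ResolutionOfSingularities.Theorems.PIDim4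

end
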